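import Mathlib
import HarnessLib
import Summits.HubbardSuperconductivity.HubbardSuperconductivity.Theorems.KLProgrammeKLRegimeSectorSlicePairFamIncrScale
import Summits.HubbardSuperconductivity.HubbardSuperconductivity.Theorems.KLProgrammeKLRegimeSectorSlicePairSectional

/-!
# K3 VL child `KLRegimeVolumeLimitV17F2` (stmt-HubbardSuperconductivity-20440), located item #23 «W2-HALF-VL» / «W2H-SEC-FAM», brick 1: the per-pair
# SECTIONAL (fixed-time, spatially weighted) bound for an increment-type multiplier of amplitude `A` in k3c3-p2's FAMILY-INCREMENT SCALE CLASS

Cell `gate-hubbard-kl`, seat p3 (g13), lead of #23.  The fixed-time twin of k3c3-p2's D5a `slicePairWt_charSum_l1_le_famIncrScale`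
(`…SectorSlicePairFamIncrScale`, p591953): SAME multiplier data (amplitude `A`, space differences in relative scale form with the iso family `r` and the
tangent family `rv` at depth `x`, tangency datum `τ ≤ b·η_v`), SAME band data (`K₁ ≤ b`, `K₂ ≤ b₂+b₂′x`, `K₃ ≤ b₃+b₃′x`, cutoff `B₁ B₂ B₃`), SAME eleven
spatial threshold conditions (`famIncr_rate_three_le` ×3, `famIncr_rate_two_le`) — but NO time data (`θ`, `s₀`-condition, `Λ′ < π(2M−5)/β`) and the support
count replaced by the two SECTION counts `Nt` (time sections of the support) and `Nsp` (spatial support per time section): the core is p3 g11's sectional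
pair lemma `slicePairWt_charSum_l1_sectional_le` (`…SectorSlicePairSectional`) instead of `slicePairWt_charSum_l1_le`.  Result, for EVERY time difference
`z₁`: `Σ_{z₂} (1 + (ρ/x)|z̃₂|₁)·‖Σ_q χχ • (βL²)⁻²(Gs·Ψ̂)(q)‖ ≤ Nt·(x·√(524288(1/s₀+1)[(1+4√2)²(2√2/ρ+2)(2√2/ρ₃+2) + (1/ρ+1)²])·√(24·L²·Nsp)·(A·(βL²)⁻²·4βL²/Λ))`
— ε-FREE (no `2M`).  Feeds the sectional family piece of the #23 telescope (`secRowWt_sliceCT_familySub_le_of_pairBounds`, p603596) once instantiated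
with the fat increment pair (brick 2, twin of D5c).

* `secCharSum_amplitude_eq` — fixed-time amplitude homogeneity;
* **`slicePairWt_charSum_sectional_le_famIncrScale`**.

Everything is proved; no definitions; nothing asserts any stub, K3, VL or superconductivity. [cite: BenfattoGiulianiMastropietro2006, §2.8 (2.81), §3 (3.2)–(3.8)]
-/

noncomputable section

namespace Summit.HubbardSuperconductivity.HubbardSuperconductivity.Theorems.TorusFourierL2

set_option linter.dupNamespace false -- summit = problem name (single-conjunct summit), D-0017

open Finset Complex Literature.MathematicalPhysics.QuantumLattice Literature.Probability.LatticeModels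
open Summit.HubbardSuperconductivity.HubbardSuperconductivity.Theorems.DispersionFlow
open scoped Real

section Amplitude

variable {P L : ℕ} [NeZero P] [NeZero L]

/-- **Fixed-time homogeneity in the amplitude**: for a real `A ≥ 0` and every time difference `z₁`, the spatially weighted `ℓ¹` norm over `z₂` of the
character sum of `c₀·((A•f)·Ψ)` is `A` times that of `c₀·(f·Ψ)`. [cite: BenfattoGiulianiMastropietro2006, §2.5 (2.52)] -/
theorem secCharSum_amplitude_eq (w : TorusSite 2 L → ℝ) (z₁ : TorusSite 1 P) (c₀ : ℂ) (f Ψ : TorusSite 1 P × TorusSite 2 L → ℂ) {A : ℝ} (hA : 0 ≤ A) :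
    ∑ z₂ : TorusSite 2 L, w z₂ * ‖∑ q : TorusSite 1 P × TorusSite 2 L, (torusChar q.1 z₁ * torusChar q.2 z₂) • (c₀ * ((A • f) q * Ψ q))‖ =
      A * ∑ z₂ : TorusSite 2 L, w z₂ * ‖∑ q : TorusSite 1 P × TorusSite 2 L, (torusChar q.1 z₁ * torusChar q.2 z₂) • (c₀ * (f q * Ψ q))‖ := by
  rw [Finset.mul_sum]
  refine Finset.sum_congr rfl fun z₂ _ => ?_
  have h : ∑ q : TorusSite 1 P × TorusSite 2 L, (torusChar q.1 z₁ * torusChar q.2 z₂) • (c₀ * ((A • f) q * Ψ q)) =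
      (A : ℂ) * ∑ q : TorusSite 1 P × TorusSite 2 L, (torusChar q.1 z₁ * torusChar q.2 z₂) • (c₀ * (f q * Ψ q)) := by
    rw [Finset.mul_sum]
    refine Finset.sum_congr rfl fun q _ => ?_
    rw [Pi.smul_apply, Complex.real_smul, smul_eq_mul, smul_eq_mul]; ring
  rw [h, norm_mul, Complex.norm_real, Real.norm_eq_abs, abs_of_nonneg hA]; ring

end Amplitude

section Pair

variable {L M : ℕ} [NeZero L] [NeZero M]

set_option maxHeartbeats 1600000 in
/-- **The per-pair SECTIONAL bound for an increment-type multiplier of amplitude `A`, FULL band, rates solved** (see the module docstring): fixed-time twin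
of `slicePairWt_charSum_l1_le_famIncrScale`. [cite: BenfattoGiulianiMastropietro2006, §2.8 (2.81), §3 (3.2)–(3.8)] -/
theorem slicePairWt_charSum_sectional_le_famIncrScale {β μ Λ Λ' : ℝ} {K : TrigPolyC4v} (hβ : 0 < β) (hΛ : 0 < Λ) (hΛΛ' : Λ ≤ Λ')
    {x b b₂ b₂' b₃ b₃' : ℝ} (hx : 1 ≤ x) (hb : 0 ≤ b)
    {K₁ K₂ K₃ : ℝ} (hK₁ : ∀ p, ‖fderiv ℝ (frameLevel μ K) p‖ ≤ K₁) (hK₂ : ∀ p, ‖iteratedFDeriv ℝ 2 (frameLevel μ K) p‖ ≤ K₂)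
    (hK₃ : ∀ p, ‖iteratedFDeriv ℝ 3 (frameLevel μ K) p‖ ≤ K₃) (hK₁b : K₁ ≤ b) (hK₂x : K₂ ≤ b₂ + b₂' * x) (hK₃x : K₃ ≤ b₃ + b₃' * x)
    {B₁ B₂ B₃ : ℝ} (hB₁ : ∀ x, |deriv salmhoferCutoff x| ≤ B₁) (hB₂ : ∀ x, |deriv (deriv salmhoferCutoff) x| ≤ B₂)
    (hB₃ : ∀ x, |deriv (deriv (deriv salmhoferCutoff)) x| ≤ B₃)
    -- the multiplier: amplitude, sup, support, tangent vector
    (Gs : TorusSite 1 (2 * M) × TorusSite 2 L → ℂ) {A : ℝ} (hA : 0 < A) (hsup : ∀ q, ‖Gs q‖ ≤ A) {Nt Nsp : ℕ}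
    (hsuppT : (univ.filter fun q₁ : TorusSite 1 (2 * M) => ∃ k, Gs (q₁, k) ≠ 0).card ≤ Nt)
    (hsuppS : ∀ q₁ : TorusSite 1 (2 * M), (univ.filter fun k : TorusSite 2 L => Gs (q₁, k) ≠ 0).card ≤ Nsp) (v : Fin 2 → ℤ) (hv : v ≠ 0)
    -- space differences in relative scale form: iso family `r` (axes, normal), tangent family `rv`
    {r₁₀ r₁₁ r₂₀ r₂₁ r₂₂ r₃₀ r₃₁ r₃₂ r₃₃ : ℝ} (hr : 0 ≤ r₁₀ ∧ 0 ≤ r₁₁ ∧ 0 ≤ r₂₀ ∧ 0 ≤ r₂₁ ∧ 0 ≤ r₂₂ ∧ 0 ≤ r₃₀ ∧ 0 ≤ r₃₁ ∧ 0 ≤ r₃₂ ∧ 0 ≤ r₃₃)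
    {rv₁₀ rv₁₁ rv₂₀ rv₂₁ rv₂₂ rv₃₀ rv₃₁ rv₃₂ rv₃₃ : ℝ}
    (hrv : 0 ≤ rv₁₀ ∧ 0 ≤ rv₁₁ ∧ 0 ≤ rv₂₀ ∧ 0 ≤ rv₂₁ ∧ 0 ≤ rv₂₂ ∧ 0 ≤ rv₃₀ ∧ 0 ≤ rv₃₁ ∧ 0 ≤ rv₃₂ ∧ 0 ≤ rv₃₃)
    (hMe₁ : ∀ q (i : Fin 2), ‖fwdDiff ((0 : TorusSite 1 (2 * M)), (Pi.single i (1 : ZMod L) : TorusSite 2 L)) Gs q‖ ≤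
      A * (‖(WithLp.toLp 2 (fun j => 2 * π / L * ((Pi.single i (1 : ℤ) : Fin 2 → ℤ) j : ℝ)) : EuclideanSpace ℝ (Fin 2))‖ * (r₁₀ + r₁₁ * x)))
    (hMe₂ : ∀ q (i : Fin 2), ‖(fwdDiff ((0 : TorusSite 1 (2 * M)), (Pi.single i (1 : ZMod L) : TorusSite 2 L)))^[2] Gs q‖ ≤
      A * (‖(WithLp.toLp 2 (fun j => 2 * π / L * ((Pi.single i (1 : ℤ) : Fin 2 → ℤ) j : ℝ)) : EuclideanSpace ℝ (Fin 2))‖ ^ 2 *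
        (r₂₀ + r₂₁ * x + r₂₂ * x ^ 2)))
    (hMe₃ : ∀ q (i : Fin 2), ‖(fwdDiff ((0 : TorusSite 1 (2 * M)), (Pi.single i (1 : ZMod L) : TorusSite 2 L)))^[3] Gs q‖ ≤
      A * (‖(WithLp.toLp 2 (fun j => 2 * π / L * ((Pi.single i (1 : ℤ) : Fin 2 → ℤ) j : ℝ)) : EuclideanSpace ℝ (Fin 2))‖ ^ 3 *
        (r₃₀ + r₃₁ * x + r₃₂ * x ^ 2 + r₃₃ * x ^ 3)))
    (hMn₁ : ∀ q, ‖fwdDiff ((0 : TorusSite 1 (2 * M)), (fun j => ((![-v 1, v 0] j : ℤ) : ZMod L))) Gs q‖ ≤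
      A * (‖(WithLp.toLp 2 (fun j => 2 * π / L * ((![-v 1, v 0] : Fin 2 → ℤ) j : ℝ)) : EuclideanSpace ℝ (Fin 2))‖ * (r₁₀ + r₁₁ * x)))
    (hMn₂ : ∀ q, ‖(fwdDiff ((0 : TorusSite 1 (2 * M)), (fun j => ((![-v 1, v 0] j : ℤ) : ZMod L))))^[2] Gs q‖ ≤
      A * (‖(WithLp.toLp 2 (fun j => 2 * π / L * ((![-v 1, v 0] : Fin 2 → ℤ) j : ℝ)) : EuclideanSpace ℝ (Fin 2))‖ ^ 2 *
        (r₂₀ + r₂₁ * x + r₂₂ * x ^ 2)))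
    (hMn₃ : ∀ q, ‖(fwdDiff ((0 : TorusSite 1 (2 * M)), (fun j => ((![-v 1, v 0] j : ℤ) : ZMod L))))^[3] Gs q‖ ≤
      A * (‖(WithLp.toLp 2 (fun j => 2 * π / L * ((![-v 1, v 0] : Fin 2 → ℤ) j : ℝ)) : EuclideanSpace ℝ (Fin 2))‖ ^ 3 *
        (r₃₀ + r₃₁ * x + r₃₂ * x ^ 2 + r₃₃ * x ^ 3)))
    (hMv₁ : ∀ q, ‖fwdDiff ((0 : TorusSite 1 (2 * M)), (fun j => ((v j : ℤ) : ZMod L))) Gs q‖ ≤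
      A * (‖(WithLp.toLp 2 (fun j => 2 * π / L * (v j : ℝ)) : EuclideanSpace ℝ (Fin 2))‖ * (rv₁₀ + rv₁₁ * x)))
    (hMv₂ : ∀ q, ‖(fwdDiff ((0 : TorusSite 1 (2 * M)), (fun j => ((v j : ℤ) : ZMod L))))^[2] Gs q‖ ≤
      A * (‖(WithLp.toLp 2 (fun j => 2 * π / L * (v j : ℝ)) : EuclideanSpace ℝ (Fin 2))‖ ^ 2 * (rv₂₀ + rv₂₁ * x + rv₂₂ * x ^ 2)))
    (hMv₃ : ∀ q, ‖(fwdDiff ((0 : TorusSite 1 (2 * M)), (fun j => ((v j : ℤ) : ZMod L))))^[3] Gs q‖ ≤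
      A * (‖(WithLp.toLp 2 (fun j => 2 * π / L * (v j : ℝ)) : EuclideanSpace ℝ (Fin 2))‖ ^ 3 * (rv₃₀ + rv₃₁ * x + rv₃₂ * x ^ 2 + rv₃₃ * x ^ 3)))
    -- the tangency datum of the band on the support, and the lattice-resolution conditions
    {τ : ℝ} (hτ0 : 0 ≤ τ)
    (hτ : ∀ q, Gs q ≠ 0 → |fderiv ℝ (frameLevel μ K) (WithLp.toLp 2 (torusCentredMomentum L q.2))
      (WithLp.toLp 2 (fun i => 2 * π / L * (v i : ℝ)))| ≤ τ)
    (hτb : τ ≤ b * ‖(WithLp.toLp 2 (fun j => 2 * π / L * (v j : ℝ)) : EuclideanSpace ℝ (Fin 2))‖)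
    (hK₂ηe : K₂ * (2 * π / L) ≤ b) (hK₂ηv : K₂ * ‖(WithLp.toLp 2 (fun j => 2 * π / L * (v j : ℝ)) : EuclideanSpace ℝ (Fin 2))‖ ≤ b)
    -- rates (`s₀ > 0` free), the coefficients and thresholds
    {s₀ ρ ρ₃ k₁ k₂ k₃ : ℝ} (hs₀ : 0 < s₀) (hρ : 0 < ρ) (hρ₃ : 0 < ρ₃)
    (hk₁ : k₁ = (16 * B₁ + 16) / Λ ^ 2) (hk₂ : k₂ = (32 * B₂ + 144 * B₁ + 128) / Λ ^ 3) (hk₃ : k₃ = (64 * B₃ + 480 * B₂ + 1728 * B₁ + 1536) / Λ ^ 4)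
    {C₀ C₁ C₂ C₃ Cv₀ Cv₁ Cv₂ Cv₃ Cw₀ Cw₁ Cw₂ Kc Kw : ℝ}
    (hC₀ : C₀ = 343 * k₃ * (β * (L : ℝ) ^ 2) * b ^ 3 + 21 * k₂ * (β * (L : ℝ) ^ 2) * b * b₂ + k₁ * (β * (L : ℝ) ^ 2) * b₃ +
      3 * r₁₀ * (36 * k₂ * (β * (L : ℝ) ^ 2) * b ^ 2 + k₁ * (β * (L : ℝ) ^ 2) * b₂) + 15 * r₂₀ * k₁ * (β * (L : ℝ) ^ 2) * b + r₃₀ * (4 * (β * (L : ℝ) ^ 2) / Λ))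
    (hC₁ : C₁ = 21 * k₂ * (β * (L : ℝ) ^ 2) * b * b₂' + k₁ * (β * (L : ℝ) ^ 2) * b₃' + 3 * r₁₁ * (36 * k₂ * (β * (L : ℝ) ^ 2) * b ^ 2 + k₁ * (β * (L : ℝ) ^ 2) * b₂) +
      3 * r₁₀ * (k₁ * (β * (L : ℝ) ^ 2) * b₂') + 15 * r₂₁ * k₁ * (β * (L : ℝ) ^ 2) * b + r₃₁ * (4 * (β * (L : ℝ) ^ 2) / Λ))
    (hC₂ : C₂ = 3 * r₁₁ * (k₁ * (β * (L : ℝ) ^ 2) * b₂') + 15 * r₂₂ * k₁ * (β * (L : ℝ) ^ 2) * b + r₃₂ * (4 * (β * (L : ℝ) ^ 2) / Λ))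
    (hC₃ : C₃ = r₃₃ * (4 * (β * (L : ℝ) ^ 2) / Λ))
    (hCv₀ : Cv₀ = 343 * k₃ * (β * (L : ℝ) ^ 2) * b ^ 3 + 21 * k₂ * (β * (L : ℝ) ^ 2) * b * b₂ + k₁ * (β * (L : ℝ) ^ 2) * b₃ +
      3 * rv₁₀ * (36 * k₂ * (β * (L : ℝ) ^ 2) * b ^ 2 + k₁ * (β * (L : ℝ) ^ 2) * b₂) + 15 * rv₂₀ * k₁ * (β * (L : ℝ) ^ 2) * b + rv₃₀ * (4 * (β * (L : ℝ) ^ 2) / Λ))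
    (hCv₁ : Cv₁ = 21 * k₂ * (β * (L : ℝ) ^ 2) * b * b₂' + k₁ * (β * (L : ℝ) ^ 2) * b₃' + 3 * rv₁₁ * (36 * k₂ * (β * (L : ℝ) ^ 2) * b ^ 2 + k₁ * (β * (L : ℝ) ^ 2) * b₂) +
      3 * rv₁₀ * (k₁ * (β * (L : ℝ) ^ 2) * b₂') + 15 * rv₂₁ * k₁ * (β * (L : ℝ) ^ 2) * b + rv₃₁ * (4 * (β * (L : ℝ) ^ 2) / Λ))
    (hCv₂ : Cv₂ = 3 * rv₁₁ * (k₁ * (β * (L : ℝ) ^ 2) * b₂') + 15 * rv₂₂ * k₁ * (β * (L : ℝ) ^ 2) * b + rv₃₂ * (4 * (β * (L : ℝ) ^ 2) / Λ))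
    (hCv₃ : Cv₃ = rv₃₃ * (4 * (β * (L : ℝ) ^ 2) / Λ))
    (hCw₀ : Cw₀ = 25 * k₂ * (β * (L : ℝ) ^ 2) * b ^ 2 + k₁ * (β * (L : ℝ) ^ 2) * b₂ + 8 * rv₁₀ * k₁ * (β * (L : ℝ) ^ 2) * b + rv₂₀ * (4 * (β * (L : ℝ) ^ 2) / Λ))
    (hCw₁ : Cw₁ = k₁ * (β * (L : ℝ) ^ 2) * b₂' + 8 * rv₁₁ * k₁ * (β * (L : ℝ) ^ 2) * b + rv₂₁ * (4 * (β * (L : ℝ) ^ 2) / Λ))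
    (hCw₂ : Cw₂ = rv₂₂ * (4 * (β * (L : ℝ) ^ 2) / Λ))
    (hKc : Kc = 32 * (β * (L : ℝ) ^ 2) / (π ^ 3 * Λ)) (hKw : Kw = 16 * (β * (L : ℝ) ^ 2) / (π ^ 2 * Λ))
    (th₃ : 4 * C₃ * ρ ^ 3 ≤ Kc) (th₂ : 4 * C₂ * ρ ^ 3 ≤ Kc * x) (th₁ : 4 * C₁ * ρ ^ 3 ≤ Kc * x ^ 2) (th₀ : 4 * C₀ * ρ ^ 3 ≤ Kc * x ^ 3)
    (tv₃ : 4 * Cv₃ * ρ ^ 3 ≤ Kc) (tv₂ : 4 * Cv₂ * ρ ^ 3 ≤ Kc * x) (tv₁ : 4 * Cv₁ * ρ ^ 3 ≤ Kc * x ^ 2) (tv₀ : 4 * Cv₀ * ρ ^ 3 ≤ Kc * x ^ 3)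
    (tw₂ : 3 * Cw₂ * ρ₃ ^ 2 ≤ Kw) (tw₁ : 3 * Cw₁ * ρ₃ ^ 2 ≤ Kw * x) (tw₀ : 3 * Cw₀ * ρ₃ ^ 2 ≤ Kw * x ^ 2) :
    ∀ z₁ : TorusSite 1 (2 * M), ∑ z₂ : TorusSite 2 L,
        (1 + ρ / x * |(((z₂ 0).valMinAbs : ℤ) : ℝ)| + ρ / x * |(((z₂ 1).valMinAbs : ℤ) : ℝ)|) *
        ‖∑ q : TorusSite 1 (2 * M) × TorusSite 2 L, (torusChar q.1 z₁ * torusChar q.2 z₂) •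
          ((((1 / (β * (L : ℝ) ^ 2) : ℝ) : ℂ) ^ 2 *
            (Gs q * sliceSymbolFnXi (β * (L : ℝ) ^ 2) 0 Λ Λ' (matsubaraFreq β M ⟨(q.1 0).val, ZMod.val_lt (q.1 0)⟩) (nambuXiCT L μ K q.2))))‖ ≤
      Nt * (x * Real.sqrt (524288 * (1 / s₀ + 1) * ((1 + 4 * Real.sqrt 2) ^ 2 * ((2 * Real.sqrt 2 / ρ + 2) * (2 * Real.sqrt 2 / ρ₃ + 2)) + (1 / ρ + 1) ^ 2)) *
        Real.sqrt (24 * (L : ℝ) ^ 2 * Nsp) * (A * ((1 / (β * (L : ℝ) ^ 2)) ^ 2 * (4 * (β * (L : ℝ) ^ 2) / Λ)))) := by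
  intro z₁
  classical
  have hL : (0 : ℝ) < L := Nat.cast_pos.2 (Nat.pos_of_ne_zero (NeZero.ne L))
  have hx0 : 0 < x := lt_of_lt_of_le one_pos hx
  have hπ : 0 < π := Real.pi_pos
  set V : ℝ := Real.sqrt ((v 0 : ℝ) ^ 2 + (v 1 : ℝ) ^ 2) with hVdef
  have hV : 0 < V := sqrt_sq_add_sq_pos_of_ne_zero v hv
  obtain ⟨h10, h11, h20, h21, h22, h30, h31, h32, h33⟩ := hr
  obtain ⟨hv10, hv11, hv20, hv21, hv22, hv30, hv31, hv32, hv33⟩ := hrv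
  -- nonnegativity of the data
  have hB10 : 0 ≤ B₁ := (abs_nonneg _).trans (hB₁ 0)
  have hB20 : 0 ≤ B₂ := (abs_nonneg _).trans (hB₂ 0)
  have hB30 : 0 ≤ B₃ := (abs_nonneg _).trans (hB₃ 0)
  have hK10 : 0 ≤ K₁ := le_trans (norm_nonneg _) (hK₁ 0)
  have hK20 : 0 ≤ K₂ := le_trans (norm_nonneg _) (hK₂ 0)
  have hk₁0 : 0 ≤ k₁ := by rw [hk₁]; positivity
  have hk₂0 : 0 ≤ k₂ := by rw [hk₂]; positivity
  have hk₃0 : 0 ≤ k₃ := by rw [hk₃]; positivity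
  have hc₀ : 0 ≤ (1 / (β * (L : ℝ) ^ 2)) ^ 2 := by positivity
  have hc : 0 ≤ β * (L : ℝ) ^ 2 := by positivity
  have hR₁ : 0 ≤ r₁₀ + r₁₁ * x := by positivity
  have hR₂ : 0 ≤ r₂₀ + r₂₁ * x + r₂₂ * x ^ 2 := by positivity
  have hR₃ : 0 ≤ r₃₀ + r₃₁ * x + r₃₂ * x ^ 2 + r₃₃ * x ^ 3 := by positivity
  have hRv₁ : 0 ≤ rv₁₀ + rv₁₁ * x := by positivity
  have hRv₂ : 0 ≤ rv₂₀ + rv₂₁ * x + rv₂₂ * x ^ 2 := by positivity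
  have hRv₃ : 0 ≤ rv₃₀ + rv₃₁ * x + rv₃₂ * x ^ 2 + rv₃₃ * x ^ 3 := by positivity
  -- the step norms
  have hηe : ∀ i : Fin 2, ‖(WithLp.toLp 2 (fun j => 2 * π / L * ((Pi.single i (1 : ℤ) : Fin 2 → ℤ) j : ℝ)) : EuclideanSpace ℝ (Fin 2))‖ = 2 * π / L := by
    intro i
    rw [norm_toLp_latticeStep]
    fin_cases i <;> simp
  have hηn : ‖(WithLp.toLp 2 (fun j => 2 * π / L * ((![-v 1, v 0] : Fin 2 → ℤ) j : ℝ)) : EuclideanSpace ℝ (Fin 2))‖ = 2 * π / L * V := by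
    rw [norm_toLp_latticeStep, hVdef]
    congr 1
    simp only [Matrix.cons_val_zero, Matrix.cons_val_one, Int.cast_neg]
    ring_nf
  have hηv : ‖(WithLp.toLp 2 (fun j => 2 * π / L * (v j : ℝ)) : EuclideanSpace ℝ (Fin 2))‖ = 2 * π / L * V := norm_toLp_latticeStep L v
  have hK₂ηn : K₂ * ‖(WithLp.toLp 2 (fun j => 2 * π / L * ((![-v 1, v 0] : Fin 2 → ℤ) j : ℝ)) : EuclideanSpace ℝ (Fin 2))‖ ≤ b := by
    rw [hηn, ← hηv]; exact hK₂ηv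
  -- the normalised multiplier
  obtain ⟨hM0, hiff, hdiv⟩ := normalisedMultiplier_data Gs hA hsup
  set Mf : TorusSite 1 (2 * M) × TorusSite 2 L → ℂ := A⁻¹ • Gs with hMf
  have hsuppTM : (univ.filter fun q₁ : TorusSite 1 (2 * M) => ∃ k, Mf (q₁, k) ≠ 0).card ≤ Nt := by
    have e : (univ.filter fun q₁ : TorusSite 1 (2 * M) => ∃ k, Mf (q₁, k) ≠ 0) =
        (univ.filter fun q₁ : TorusSite 1 (2 * M) => ∃ k, Gs (q₁, k) ≠ 0) :=
      Finset.filter_congr fun q₁ _ => exists_congr fun k => hiff (q₁, k)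
    rw [e]; exact hsuppT
  have hsuppSM : ∀ q₁ : TorusSite 1 (2 * M), (univ.filter fun k : TorusSite 2 L => Mf (q₁, k) ≠ 0).card ≤ Nsp := fun q₁ => by
    have e : (univ.filter fun k : TorusSite 2 L => Mf (q₁, k) ≠ 0) = (univ.filter fun k : TorusSite 2 L => Gs (q₁, k) ≠ 0) :=
      Finset.filter_congr fun k _ => hiff (q₁, k)
    rw [e]; exact hsuppS q₁
  have hτM : ∀ q, Mf q ≠ 0 → |fderiv ℝ (frameLevel μ K) (WithLp.toLp 2 (torusCentredMomentum L q.2))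
      (WithLp.toLp 2 (fun i => 2 * π / L * (v i : ℝ)))| ≤ τ := fun q hq => hτ q ((hiff q).1 hq)
  have hdiv1 : ∀ (h : TorusSite 1 (2 * M) × TorusSite 2 L) (q : TorusSite 1 (2 * M) × TorusSite 2 L) (D : ℝ),
      ‖fwdDiff h Gs q‖ ≤ A * D → ‖fwdDiff h Mf q‖ ≤ D := by
    intro h q D hD
    have h1 := hdiv h 1 q (A * D) (by simpa only [Function.iterate_one] using hD)
    rw [Function.iterate_one, mul_div_cancel_left₀ _ hA.ne'] at h1
    exact h1
  have hdivk : ∀ (h : TorusSite 1 (2 * M) × TorusSite 2 L) (k : ℕ) (q : TorusSite 1 (2 * M) × TorusSite 2 L) (D : ℝ),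
      ‖((fwdDiff h)^[k] Gs) q‖ ≤ A * D → ‖((fwdDiff h)^[k] Mf) q‖ ≤ D := by
    intro h k q D hD
    have h1 := hdiv h k q (A * D) hD
    rw [mul_div_cancel_left₀ _ hA.ne'] at h1
    exact h1
  -- the master pair lemma with the solved rates
  have main := slicePairWt_charSum_l1_sectional_le (K := K) hβ hΛ hΛΛ' hK₁ hK₂ hK₃ hB₁ hB₂ hB₃ Mf hM0 v hv
    (R₀ := 0) (by push_cast; rw [mul_zero]; exact_mod_cast Nat.pos_of_ne_zero (NeZero.ne L)) hsuppTM hsuppSM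
    (fun i => ‖(WithLp.toLp 2 (fun j => 2 * π / L * ((Pi.single i (1 : ℤ) : Fin 2 → ℤ) j : ℝ)) : EuclideanSpace ℝ (Fin 2))‖ * (r₁₀ + r₁₁ * x))
    (fun i => ‖(WithLp.toLp 2 (fun j => 2 * π / L * ((Pi.single i (1 : ℤ) : Fin 2 → ℤ) j : ℝ)) : EuclideanSpace ℝ (Fin 2))‖ ^ 2 *
      (r₂₀ + r₂₁ * x + r₂₂ * x ^ 2))
    (fun i => ‖(WithLp.toLp 2 (fun j => 2 * π / L * ((Pi.single i (1 : ℤ) : Fin 2 → ℤ) j : ℝ)) : EuclideanSpace ℝ (Fin 2))‖ ^ 3 *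
      (r₃₀ + r₃₁ * x + r₃₂ * x ^ 2 + r₃₃ * x ^ 3))
    (fun i => by positivity) (fun i => by positivity) (fun i => by positivity)
    (fun q i => hdiv1 _ q _ (hMe₁ q i)) (fun q i => hdivk _ 2 q _ (hMe₂ q i)) (fun q i => hdivk _ 3 q _ (hMe₃ q i))
    (by positivity : 0 ≤ ‖(WithLp.toLp 2 (fun j => 2 * π / L * ((![-v 1, v 0] : Fin 2 → ℤ) j : ℝ)) : EuclideanSpace ℝ (Fin 2))‖ * (r₁₀ + r₁₁ * x))
    (by positivity : 0 ≤ ‖(WithLp.toLp 2 (fun j => 2 * π / L * ((![-v 1, v 0] : Fin 2 → ℤ) j : ℝ)) : EuclideanSpace ℝ (Fin 2))‖ ^ 2 *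
      (r₂₀ + r₂₁ * x + r₂₂ * x ^ 2))
    (by positivity : 0 ≤ ‖(WithLp.toLp 2 (fun j => 2 * π / L * ((![-v 1, v 0] : Fin 2 → ℤ) j : ℝ)) : EuclideanSpace ℝ (Fin 2))‖ ^ 3 *
      (r₃₀ + r₃₁ * x + r₃₂ * x ^ 2 + r₃₃ * x ^ 3))
    (fun q => hdiv1 _ q _ (hMn₁ q)) (fun q => hdivk _ 2 q _ (hMn₂ q)) (fun q => hdivk _ 3 q _ (hMn₃ q))
    (by positivity : 0 ≤ ‖(WithLp.toLp 2 (fun j => 2 * π / L * (v j : ℝ)) : EuclideanSpace ℝ (Fin 2))‖ * (rv₁₀ + rv₁₁ * x))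
    (by positivity : 0 ≤ ‖(WithLp.toLp 2 (fun j => 2 * π / L * (v j : ℝ)) : EuclideanSpace ℝ (Fin 2))‖ ^ 2 * (rv₂₀ + rv₂₁ * x + rv₂₂ * x ^ 2))
    (by positivity : 0 ≤ ‖(WithLp.toLp 2 (fun j => 2 * π / L * (v j : ℝ)) : EuclideanSpace ℝ (Fin 2))‖ ^ 3 *
      (rv₃₀ + rv₃₁ * x + rv₃₂ * x ^ 2 + rv₃₃ * x ^ 3))
    (fun q => hdiv1 _ q _ (hMv₁ q)) (fun q => hdivk _ 2 q _ (hMv₂ q)) (fun q => hdivk _ 3 q _ (hMv₃ q))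
    hτ0 hτM
    (s₀ := s₀) (s₁ := ρ / x) (s₂ := ρ / x / V) (s₃ := ρ₃ / x / V) (s₃' := ρ / x / V)
    hs₀ (by positivity) (by positivity) (by positivity) (by positivity)
    -- axes
    (fun i => by
      refine (mul_le_mul_of_nonneg_left (famIncr_rate_three_le (c := β * (L : ℝ) ^ 2) hc hΛ hk₁ hk₂ hk₃ hk₁0 hk₂0 hk₃0 (norm_nonneg _) hx hρ hb
        (mul_nonneg hK10 (norm_nonneg _)) hK20 hK₂x hK₃x (mul_le_mul_of_nonneg_right hK₁b (norm_nonneg _)) (by rw [hηe i]; exact hK₂ηe)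
        ⟨h10, h11, h20, h21, h22, h30, h31, h32, h33⟩ (le_of_eq (by ring)) (le_of_eq (by ring)) (le_of_eq (by ring))
        hC₀ hC₁ hC₂ hC₃ hKc th₃ th₂ th₁ th₀) hc₀).trans_eq ?_
      rw [hηe i]
      field_simp
      ring)
    -- normal
    (by
      refine (mul_le_mul_of_nonneg_left (famIncr_rate_three_le (c := β * (L : ℝ) ^ 2) hc hΛ hk₁ hk₂ hk₃ hk₁0 hk₂0 hk₃0 (norm_nonneg _) hx hρ hb
        (mul_nonneg hK10 (norm_nonneg _)) hK20 hK₂x hK₃x (mul_le_mul_of_nonneg_right hK₁b (norm_nonneg _)) hK₂ηn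
        ⟨h10, h11, h20, h21, h22, h30, h31, h32, h33⟩ (le_of_eq (by ring)) (le_of_eq (by ring)) (le_of_eq (by ring))
        hC₀ hC₁ hC₂ hC₃ hKc th₃ th₂ th₁ th₀) hc₀).trans_eq ?_
      rw [hηn]
      field_simp
      ring)
    -- tangent, order two
    (by
      refine (mul_le_mul_of_nonneg_left (famIncr_rate_two_le (c := β * (L : ℝ) ^ 2) hc hΛ hk₁ hk₂ hk₁0 hk₂0 (norm_nonneg _) hx hρ₃ hτ0 hK20
        hK₂x hτb hK₂ηv ⟨hv10, hv11, hv20, hv21, hv22⟩ (le_of_eq (by ring)) (le_of_eq (by ring)) hCw₀ hCw₁ hCw₂ hKw tw₂ tw₁ tw₀) hc₀).trans_eq ?_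
      rw [hηv]
      field_simp
      ring)
    -- tangent, order three
    (by
      refine (mul_le_mul_of_nonneg_left (famIncr_rate_three_le (c := β * (L : ℝ) ^ 2) hc hΛ hk₁ hk₂ hk₃ hk₁0 hk₂0 hk₃0 (norm_nonneg _) hx hρ hb
        hτ0 hK20 hK₂x hK₃x hτb hK₂ηv
        ⟨hv10, hv11, hv20, hv21, hv22, hv30, hv31, hv32, hv33⟩ (le_of_eq (by ring)) (le_of_eq (by ring)) (le_of_eq (by ring))
        hCv₀ hCv₁ hCv₂ hCv₃ hKc tv₃ tv₂ tv₁ tv₀) hc₀).trans_eq ?_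
      rw [hηv]
      field_simp
      ring)
  -- the left side is `A` times that of the normalised multiplier
  have hGsM : Gs = A • Mf := by
    rw [hMf, smul_smul, mul_inv_cancel₀ hA.ne', one_smul]
  rw [hGsM, secCharSum_amplitude_eq _ z₁ _ _ _ hA.le]
  have hA₀ : 0 ≤ (1 / (β * (L : ℝ) ^ 2)) ^ 2 * (4 * (β * (L : ℝ) ^ 2) / Λ) := by positivity
  -- simplify the prefactor: `(ρ/x/V)·V = ρ/x`, `R₀ = 0`, and pull out `x`
  have e1 : ρ / x / V * V = ρ / x := div_mul_cancel₀ _ hV.ne'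
  have e2 : ρ₃ / x / V * V = ρ₃ / x := div_mul_cancel₀ _ hV.ne'
  have hrad : 524288 * (1 / s₀ + 1) *
      ((1 + 2 * Real.sqrt 2 * (ρ / x) / (ρ / x / V * V) + 2 * Real.sqrt 2 * (ρ / x) / (ρ / x / V * V)) ^ 2 *
          ((2 * Real.sqrt 2 / (ρ / x / V * V) + 2) * (2 * Real.sqrt 2 / (ρ₃ / x / V * V) + 2)) +
        (1 / (ρ / x) + 1) ^ 2 / (1 + ρ / x * ((0 : ℕ) : ℝ))) ≤
      x ^ 2 * (524288 * (1 / s₀ + 1) * ((1 + 4 * Real.sqrt 2) ^ 2 * ((2 * Real.sqrt 2 / ρ + 2) * (2 * Real.sqrt 2 / ρ₃ + 2)) + (1 / ρ + 1) ^ 2)) := by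
    rw [e1, e2, Nat.cast_zero, mul_zero, add_zero, div_one]
    have hρx : 0 < ρ / x := by positivity
    rw [mul_div_cancel_right₀ _ hρx.ne']
    have i1 : 2 * Real.sqrt 2 / (ρ / x) + 2 ≤ x * (2 * Real.sqrt 2 / ρ + 2) := by
      rw [div_div_eq_mul_div, show x * (2 * Real.sqrt 2 / ρ + 2) = 2 * Real.sqrt 2 * x / ρ + 2 * x by ring]
      linarith only [hx]
    have i2 : 2 * Real.sqrt 2 / (ρ₃ / x) + 2 ≤ x * (2 * Real.sqrt 2 / ρ₃ + 2) := by
      rw [div_div_eq_mul_div, show x * (2 * Real.sqrt 2 / ρ₃ + 2) = 2 * Real.sqrt 2 * x / ρ₃ + 2 * x by ring]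
      linarith only [hx]
    have i3 : (1 / (ρ / x) + 1) ^ 2 ≤ x ^ 2 * (1 / ρ + 1) ^ 2 := by
      rw [← mul_pow]
      apply pow_le_pow_left₀ (by positivity)
      rw [one_div_div, show x * (1 / ρ + 1) = x / ρ + x by ring]
      linarith only [hx]
    have i12 : (2 * Real.sqrt 2 / (ρ / x) + 2) * (2 * Real.sqrt 2 / (ρ₃ / x) + 2) ≤
        x ^ 2 * ((2 * Real.sqrt 2 / ρ + 2) * (2 * Real.sqrt 2 / ρ₃ + 2)) := by
      calc _ ≤ (x * (2 * Real.sqrt 2 / ρ + 2)) * (x * (2 * Real.sqrt 2 / ρ₃ + 2)) := mul_le_mul i1 i2 (by positivity) (by positivity)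
        _ = _ := by ring
    have h1 : 0 ≤ 524288 * (1 / s₀ + 1) := by positivity
    have h2 : 0 ≤ (1 + 2 * Real.sqrt 2 + 2 * Real.sqrt 2) ^ 2 := by positivity
    calc 524288 * (1 / s₀ + 1) * ((1 + 2 * Real.sqrt 2 + 2 * Real.sqrt 2) ^ 2 *
            ((2 * Real.sqrt 2 / (ρ / x) + 2) * (2 * Real.sqrt 2 / (ρ₃ / x) + 2)) + (1 / (ρ / x) + 1) ^ 2)
          ≤ 524288 * (1 / s₀ + 1) * ((1 + 2 * Real.sqrt 2 + 2 * Real.sqrt 2) ^ 2 *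
            (x ^ 2 * ((2 * Real.sqrt 2 / ρ + 2) * (2 * Real.sqrt 2 / ρ₃ + 2))) + x ^ 2 * (1 / ρ + 1) ^ 2) := by
          gcongr
      _ = x ^ 2 * (524288 * (1 / s₀ + 1) * ((1 + 4 * Real.sqrt 2) ^ 2 * ((2 * Real.sqrt 2 / ρ + 2) * (2 * Real.sqrt 2 / ρ₃ + 2)) + (1 / ρ + 1) ^ 2)) := by ring
  have hsq : Real.sqrt (524288 * (1 / s₀ + 1) *
      ((1 + 2 * Real.sqrt 2 * (ρ / x) / (ρ / x / V * V) + 2 * Real.sqrt 2 * (ρ / x) / (ρ / x / V * V)) ^ 2 *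
          ((2 * Real.sqrt 2 / (ρ / x / V * V) + 2) * (2 * Real.sqrt 2 / (ρ₃ / x / V * V) + 2)) +
        (1 / (ρ / x) + 1) ^ 2 / (1 + ρ / x * ((0 : ℕ) : ℝ)))) ≤ x * Real.sqrt (524288 * (1 / s₀ + 1) * ((1 + 4 * Real.sqrt 2) ^ 2 * ((2 * Real.sqrt 2 / ρ + 2) * (2 * Real.sqrt 2 / ρ₃ + 2)) + (1 / ρ + 1) ^ 2)) := by
    refine (Real.sqrt_le_sqrt hrad).trans_eq ?_
    rw [Real.sqrt_mul (by positivity), Real.sqrt_sq hx0.le]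
  have hfin := mul_le_mul_of_nonneg_right (mul_le_mul_of_nonneg_right hsq (Real.sqrt_nonneg (24 * (L : ℝ) ^ 2 * Nsp))) hA₀
  calc A * _ ≤ A * (Nt * (Real.sqrt (524288 * (1 / s₀ + 1) *
          ((1 + 2 * Real.sqrt 2 * (ρ / x) / (ρ / x / V * V) + 2 * Real.sqrt 2 * (ρ / x) / (ρ / x / V * V)) ^ 2 *
              ((2 * Real.sqrt 2 / (ρ / x / V * V) + 2) * (2 * Real.sqrt 2 / (ρ₃ / x / V * V) + 2)) +
            (1 / (ρ / x) + 1) ^ 2 / (1 + ρ / x * ((0 : ℕ) : ℝ)))) *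
          Real.sqrt (24 * (L : ℝ) ^ 2 * Nsp) * ((1 / (β * (L : ℝ) ^ 2)) ^ 2 * (4 * (β * (L : ℝ) ^ 2) / Λ)))) :=
        mul_le_mul_of_nonneg_left (main z₁) hA.le
    _ ≤ A * (Nt * (x * Real.sqrt (524288 * (1 / s₀ + 1) * ((1 + 4 * Real.sqrt 2) ^ 2 * ((2 * Real.sqrt 2 / ρ + 2) * (2 * Real.sqrt 2 / ρ₃ + 2)) + (1 / ρ + 1) ^ 2)) *
          Real.sqrt (24 * (L : ℝ) ^ 2 * Nsp) * ((1 / (β * (L : ℝ) ^ 2)) ^ 2 * (4 * (β * (L : ℝ) ^ 2) / Λ)))) :=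
        mul_le_mul_of_nonneg_left (mul_le_mul_of_nonneg_left hfin (Nat.cast_nonneg _)) hA.le
    _ = _ := by ring


end Pair

end Summit.HubbardSuperconductivity.HubbardSuperconductivity.Theorems.TorusFourierL2

end
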